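/-
Copyright (c) 2026 The HCML crux team. All rights reserved.
Released under Apache 2.0 license as described in the file LICENSE.
Authors: K2E5-p17 (g4) (explicit-unit `hodgecm-mathlib-K2E5-p17-g4`)
-/
import Summits.HodgeConjecture.HodgeConjecture.Theorems.K2E3GL3CuspFormCancellation   -- ★ (C) (this seat): the GL₃ dictionary, `A₃` memberships; brings (A′), (B-val), (B-Iw)
import HarnessLib

/-!
# K2_E3 road (h413), U12 «Characters» — THEOREM 20 FOR `GL₃(F)`, UPSTAIRS, RANK-ONE TORUS `A₃ = {diag(λ, λ, μ)}` (the split component of `M_{(2,1)} ⊃ T_E`):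
# for `y ∈ 𝔅_s` and `x ∉ 𝔅_{m_C + (m + 2s + 4m_C) + s}`, `∫_{GL₃(𝒪)} f(x k y) dk = 0`

Cell `pub/hodgecm-mathlib` (D-0151), Track B, seat K2E5-p17 (g4); line lead K2E3-p23 (g5) (RULINGS #12 (M12-3) «BOTH Γ = A and Γ = T_E», (M12-5) the companion normal
form `γ = leviBlock(C_π, c)`), co-owner K2E3-p21 (g5), dealer K2E3-plan (g3).  `--supports stmt-HodgeConjecture-24833 --as helper`; THEOREMS ONLY; never imports `Cruxes/…/Lines`.
COUNT-NEUTRAL.  Consumer: the `G_Λ` descent (K2E3-p21 (g5)) and ASM.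

THE MATHEMATICS [HarishChandra1970, Part VII §2 Theorem 20 p. 70; §8 pp. 80–84, rank one].  The slices `x ↦ θ(x γ x⁻¹)` at the mixed Cartan `γ ∈ T_E ⊂ M_{(2,1)}` are
supported in `𝔅_{m_C} · A₃` with `A₃ = {diag(λ,λ,μ)} = M_{id} ⊓ C(M_{(2,1)})` (T18-mixed), and are cusp forms along `N_{(2,1)}` and `N̄_{(2,1)}` (★ B4-E1, `π(c) ≠ 0`).  The
rank-one polychotomy: TWO directions `![0,0,1]` (`a⁻¹` contracts `N_{(2,1)}`) and `![1,1,0]` (`a⁻¹` contracts `N̄_{(2,1)}`), no chambers (`W = Unit`, `w = 1`), Levi defect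
`0` (`a` is central in `M_{(2,1)}`), depth `E + 1`, radius `E = m + 2s + 4m_C` (★ (B-val) part 2 `cover_blockScalar_of_not_adBall`) — print's rank-one constants, the twin of
★ U3 `cuspForm_cancellation_levelOne_U3`.  **`cuspForm_cancellation_GL3_blockScalar`**.

HONEST LABEL: HC_CM is proved only modulo the 7 printed citations (2 remaining named inputs: hLiu418 = stmt-HodgeConjecture-24832, h413 = stmt-HodgeConjecture-24833)
until rung 0 closes; count-neutral helper.

## References
* [HarishChandra1970] Harish-Chandra (notes by G. van Dijk), *Harmonic Analysis on Reductive p-adic Groups*, LNM 162 (1970), Part VII §2 Thm. 20 p. 70, §3 p. 71, §8 pp. 80–84.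
* [Casselman1995] W. Casselman, *Introduction to the theory of admissible representations of p-adic reductive groups* (1995), Prop. 1.4.3–1.4.4.
-/

set_option autoImplicit false
set_option linter.dupNamespace false   -- `Summit.HodgeConjecture.HodgeConjecture.…` (D-0017 nested layout; lakefile exemption for Summits)

noncomputable section

open scoped MatrixGroups WithZero Pointwise
open MeasureTheory MeasureTheory.Measure Matrix ValuativeRel Topology
open Literature.NumberTheory.Automorphic
open Summit.HodgeConjecture.HodgeConjecture.Cruxes.H413.K2E3GLnAdHeightBalls
open Summit.HodgeConjecture.HodgeConjecture.Cruxes.H413.K2E3GLnUnipotentAdHeight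
open Summit.HodgeConjecture.HodgeConjecture.Cruxes.H413.K2E3GLnCuspFormCancellationInputs
open Summit.HodgeConjecture.HodgeConjecture.Cruxes.H413.K2E3GL3CuspFormCancellationCover
open Summit.HodgeConjecture.HodgeConjecture.Cruxes.H413.K2E3GLnCongruenceIwahoriTriple
open Summit.HodgeConjecture.HodgeConjecture.Cruxes.H413.K2E3CuspFormCancellationPolychotomyTransport
open Summit.HodgeConjecture.HodgeConjecture.Cruxes.H413.K2E3GL3CuspFormCancellation

namespace Summit.HodgeConjecture.HodgeConjecture.Cruxes.H413.K2E3GL3CuspFormCancellationBlockScalar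

/-! ## Theorem 20 for `GL₃(F)`, `Γ = A₃ = {diag(λ, λ, μ)}`: two directions, no chambers -/

section BlockScalar

variable {F : Type*} [Field F] [Valued F ℤᵐ⁰] [ValuativeRel F] [(Valued.v : Valuation F ℤᵐ⁰).Compatible] [IsNonarchimedeanLocalField F]
  [MeasurableSpace (GL (Fin 3) F)] [BorelSpace (GL (Fin 3) F)]
  {E' : Type*} [NormedAddCommGroup E'] [NormedSpace ℝ E']

/-- **THEOREM 20 FOR `GL₃(F)` ON THE FULL LEVEL `K₁ = GL₃(𝒪)`, RANK-ONE TORUS `A₃ = {diag(λ,λ,μ)} = M_{id} ⊓ C(M_{(2,1)})`** (the support torus of the slices at the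
mixed Cartan `T_E ⊂ M_{(2,1)}`, (M12-5)): `m ≥ 1`, `y ∈ 𝔅_s`, `μ` any Haar measure, `f` continuous with `supp f ⊆ 𝔅_{m_C} · A₃` and a cusp form along `N_{(2,1)}` and
`N̄_{(2,1)}` (labels `![0,0,1]`, `![1,1,0] : Fin 3 → Fin 2`; every Haar measure).  Then for `x ∉ 𝔅_{m_C + (m + 2s + 4m_C) + s}`:  **`∫_{k ∈ GL₃(𝒪)} f(x k y) dμ(k) = 0`** —
print's rank-one constants.  ★ (A′) with `W = Unit` (`w = 1`), `ι = Fin 2`, defect `0`, depth `E + 1`, radius `E = m + 2s + 4m_C`, cover ★ `cover_blockScalar_of_not_adBall`.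
[cite: HarishChandra1970, Part VII §2 Theorem 20 p. 70; §3 p. 71; §8 pp. 80–84] [cite: Casselman1995, Prop. 1.4.3–1.4.4] -/
theorem cuspForm_cancellation_GL3_blockScalar {ϖ : F} (hϖ : Valued.v ϖ = WithZero.exp (-1 : ℤ)) (μ : Measure (GL (Fin 3) F)) [μ.IsHaarMeasure]
    {m : ℕ} (hm : 1 ≤ m) {s : ℕ} {y : GL (Fin 3) F}
    (hy : ∀ i j k l, Valued.v (ϖ ^ s * ((y : Matrix (Fin 3) (Fin 3) F) i j * ((y⁻¹ : GL (Fin 3) F) : Matrix (Fin 3) (Fin 3) F) k l)) ≤ 1)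
    (f : GL (Fin 3) F → E') (hf : Continuous f) {mC : ℕ}
    (hsupp : ∀ g, f g ≠ 0 → g ∈ {x : GL (Fin 3) F | ∀ i j k l, Valued.v (ϖ ^ mC * ((x : Matrix (Fin 3) (Fin 3) F) i j *
      ((x⁻¹ : GL (Fin 3) F) : Matrix (Fin 3) (Fin 3) F) k l)) ≤ 1} *
      ((standardLeviGL F (id : Fin 3 → Fin 3) ⊓ Subgroup.centralizer ((standardLeviGL F (![0, 0, 1] : Fin 3 → Fin 2) : Subgroup (GL (Fin 3) F)) : Set (GL (Fin 3) F)) :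
        Subgroup (GL (Fin 3) F)) : Set (GL (Fin 3) F)))
    (hcusp21 : ∀ (ν₀ : Measure ↥(unipotentRadicalGL F (![0, 0, 1] : Fin 3 → Fin 2))), ν₀.IsHaarMeasure → ∀ x : GL (Fin 3) F, ∫ u, f (x * (u : GL (Fin 3) F)) ∂ν₀ = 0)
    (hcusp21bar : ∀ (ν₀ : Measure ↥(unipotentRadicalGL F (![1, 1, 0] : Fin 3 → Fin 2))), ν₀.IsHaarMeasure → ∀ x : GL (Fin 3) F, ∫ u, f (x * (u : GL (Fin 3) F)) ∂ν₀ = 0)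
    {x : GL (Fin 3) F}
    (hx : ¬ ∀ i j k l, Valued.v (ϖ ^ (mC + (m + 2 * s + 4 * mC) + s) * ((x : Matrix (Fin 3) (Fin 3) F) i j *
      ((x⁻¹ : GL (Fin 3) F) : Matrix (Fin 3) (Fin 3) F) k l)) ≤ 1) :
    ∫ k in ((glInt 3 F : Subgroup (GL (Fin 3) F)) : Set (GL (Fin 3) F)), f (x * k * y) ∂μ = 0 := by
  classical
  haveI : T2Space F := (Literature.NumberTheory.GaloisRepresentations.IsNonarchimedeanLocalField.isLocalField F).toT2Space
  haveI : SecondCountableTopology (GL (Fin 3) F) := K2E3GL3ModCentre.secondCountableTopology_gl3 F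
  haveI : LocallyCompactSpace (GL (Fin 3) F) := K2E3GL3ModCentre.locallyCompactSpace_gl3 F
  haveI : μ.IsMulRightInvariant := GLn.isMulRightInvariant_of_isHaarMeasure_local 3 F μ
  have hϖ0 : ϖ ≠ 0 := ne_zero_of_v_eq_exp hϖ
  have hvϖ0 : valuation F ϖ ≠ 0 := (Valuation.ne_zero_iff _).2 hϖ0
  have hvϖ1 : valuation F ϖ < 1 := by
    rw [← v_lt_one_iff_valuation_lt_one, hϖ, ← WithZero.exp_zero, WithZero.exp_lt_exp]; norm_num
  have hγ1 : valuation F ϖ ^ m < 1 := pow_lt_one₀ zero_le hvϖ1 (by omega)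
  have hγ0 : valuation F ϖ ^ m ≠ 0 := pow_ne_zero _ hvϖ0
  set Ω : ℕ → Set (GL (Fin 3) F) := fun k => {g | ∀ i j a b, Valued.v (ϖ ^ k * ((g : Matrix (Fin 3) (Fin 3) F) i j *
    ((g⁻¹ : GL (Fin 3) F) : Matrix (Fin 3) (Fin 3) F) a b)) ≤ 1} with hΩ
  have hΩmem : ∀ k g, g ∈ Ω k ↔ ∀ i j a b, Valued.v (ϖ ^ k * ((g : Matrix (Fin 3) (Fin 3) F) i j * ((g⁻¹ : GL (Fin 3) F) : Matrix (Fin 3) (Fin 3) F) a b)) ≤ 1 :=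
    fun k g => Iff.rfl
  have hΩmul : ∀ {a b : ℕ} {g g' : GL (Fin 3) F}, g ∈ Ω a → g' ∈ Ω b → g * g' ∈ Ω (a + b) := fun hg hg' => adBall_mul hg hg'
  have hΩinv : ∀ {a : ℕ} {g : GL (Fin 3) F}, g ∈ Ω a → g⁻¹ ∈ Ω a := fun {a} {g} hg =>
    (hΩmem a g⁻¹).2 (by simpa only [inv_inv] using adBall_inv hg)
  set K₀ : Subgroup (GL (Fin 3) F) := congruenceGL 3 (valuation F ϖ ^ m) with hK₀
  set L : ℕ → Subgroup (GL (Fin 3) F) := fun j => congruenceGL 3 (valuation F ϖ ^ j) with hL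
  set A : Subgroup (GL (Fin 3) F) := standardLeviGL F (id : Fin 3 → Fin 3) ⊓
    Subgroup.centralizer ((standardLeviGL F (![0, 0, 1] : Fin 3 → Fin 2) : Subgroup (GL (Fin 3) F)) : Set (GL (Fin 3) F)) with hA
  set E : ℕ := m + 2 * s + 4 * mC with hE
  -- membership in `A₃`: diagonal with `d₀ = d₁`
  have hAd : ∀ a ∈ A, (a : Matrix (Fin 3) (Fin 3) F) = Matrix.diagonal (fun i => (a : Matrix (Fin 3) (Fin 3) F) i i) ∧
      (a : Matrix (Fin 3) (Fin 3) F) 0 0 = (a : Matrix (Fin 3) (Fin 3) F) 1 1 := fun a ha =>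
    ⟨coe_eq_diagonal_of_mem_standardLeviGL_id (Subgroup.mem_inf.1 ha).1,
      apply_zero_zero_eq_of_mem_centralizer (Subgroup.mem_inf.1 ha).1 (Subgroup.mem_inf.1 ha).2⟩
  -- the two directions
  set U : Fin 2 → Subgroup (GL (Fin 3) F) := ![unipotentRadicalGL F (![0, 0, 1] : Fin 3 → Fin 2), unipotentRadicalGL F (![1, 1, 0] : Fin 3 → Fin 2)] with hU
  set V : Fin 2 → Subgroup (GL (Fin 3) F) := ![unipotentRadicalGL F (⇑OrderDual.toDual ∘ (![0, 0, 1] : Fin 3 → Fin 2)),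
    unipotentRadicalGL F (⇑OrderDual.toDual ∘ (![1, 1, 0] : Fin 3 → Fin 2))] with hV
  set T : Fin 2 → Subgroup (GL (Fin 3) F) := ![standardLeviGL F (![0, 0, 1] : Fin 3 → Fin 2), standardLeviGL F (![1, 1, 0] : Fin 3 → Fin 2)] with hT
  set D : Fin 2 → ℕ := ![0, 0] with hD
  set P : Fin 2 → Set (GL (Fin 3) F) := ![
    {a | ∃ d : Fin 3 → F, (a : Matrix (Fin 3) (Fin 3) F) = Matrix.diagonal d ∧
      (∀ i j : Fin 3, (![0, 0, 1] : Fin 3 → Fin 2) i < (![0, 0, 1] : Fin 3 → Fin 2) j → Valued.v ((d i)⁻¹ * d j) ≤ Valued.v (ϖ ^ (E + 1))) ∧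
        ∀ i j : Fin 3, (![0, 0, 1] : Fin 3 → Fin 2) i = (![0, 0, 1] : Fin 3 → Fin 2) j → Valued.v (ϖ ^ 0 * (d i * (d j)⁻¹)) ≤ 1},
    {a | ∃ d : Fin 3 → F, (a : Matrix (Fin 3) (Fin 3) F) = Matrix.diagonal d ∧
      (∀ i j : Fin 3, (![1, 1, 0] : Fin 3 → Fin 2) i < (![1, 1, 0] : Fin 3 → Fin 2) j → Valued.v ((d i)⁻¹ * d j) ≤ Valued.v (ϖ ^ (E + 1))) ∧
        ∀ i j : Fin 3, (![1, 1, 0] : Fin 3 → Fin 2) i = (![1, 1, 0] : Fin 3 → Fin 2) j → Valued.v (ϖ ^ 0 * (d i * (d j)⁻¹)) ≤ 1}] with hP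
  set w : Unit → GL (Fin 3) F := fun _ => 1 with hw
  -- levels
  have hK₁Ω : ((glInt 3 F : Subgroup (GL (Fin 3) F)) : Set (GL (Fin 3) F)) ⊆ Ω 0 := fun k hk => adBall_zero_of_mem_glInt ϖ hk
  have hK₀K₁ : K₀ ≤ glInt 3 F := congruenceGL_le_glInt _
  have hK₁o : IsOpen ((glInt 3 F : Subgroup (GL (Fin 3) F)) : Set (GL (Fin 3) F)) := isOpen_glInt 3 F
  have hK₁c : IsCompact ((glInt 3 F : Subgroup (GL (Fin 3) F)) : Set (GL (Fin 3) F)) := isCompact_glInt 3 F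
  have hK₀o : IsOpen (K₀ : Set (GL (Fin 3) F)) := isOpen_congruenceGL hγ0
  have hK₀c : IsCompact (K₀ : Set (GL (Fin 3) F)) := isCompact_congruenceGL _
  have hdeep : ∀ u ∈ L (m + 2 * s), u ∈ K₀ ∧ y * u * y⁻¹ ∈ K₀ := by
    intro u hu
    have hu' : u ∈ congruenceGL 3 (valuation F ϖ ^ (m + s)) := congruenceGL_pow_le_pow hϖ (by omega) hu
    exact ⟨congruenceGL_pow_le_pow hϖ (by omega) hu, conj_mem_congruenceGL_of_adBall hϖ hy hu'⟩
  have hUc : ∀ r, IsClosed ((U r : Subgroup (GL (Fin 3) F)) : Set (GL (Fin 3) F)) := by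
    intro r; fin_cases r
    · exact isClosed_unipotentRadicalGL (![0, 0, 1] : Fin 3 → Fin 2)
    · exact isClosed_unipotentRadicalGL (![1, 1, 0] : Fin 3 → Fin 2)
  have hCΩ : {x : GL (Fin 3) F | ∀ i j k l, Valued.v (ϖ ^ mC * ((x : Matrix (Fin 3) (Fin 3) F) i j *
      ((x⁻¹ : GL (Fin 3) F) : Matrix (Fin 3) (Fin 3) F) k l)) ≤ 1} ⊆ Ω mC := fun g hg => hg
  have hcusp : ∀ (_ : Unit) (r : Fin 2), ∀ ν₀ : Measure ↥(U r), ν₀.IsHaarMeasure → ∀ x : GL (Fin 3) F,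
      ∫ u : ↥(U r), f (x * (w () * ↑u * (w ())⁻¹)) ∂ν₀ = 0 := by
    intro _ r ν₀ hν₀ x
    simp only [hw, one_mul, inv_one, mul_one]
    fin_cases r
    · exact hcusp21 ν₀ hν₀ x
    · exact hcusp21bar ν₀ hν₀ x
  -- the cover: two directions
  have hcover : ∀ a ∈ A, a ∉ Ω E → ∃ (ω : Unit) (r : Fin 2), (w ω)⁻¹ * a * w ω ∈ P r := by
    intro a ha haR
    obtain ⟨hd, h01⟩ := hAd a ha
    have hd' : (((w ())⁻¹ * a * w () : GL (Fin 3) F) : Matrix (Fin 3) (Fin 3) F) = Matrix.diagonal (fun i => (a : Matrix (Fin 3) (Fin 3) F) i i) := by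
      simpa only [hw, inv_one, one_mul, mul_one] using hd
    rcases cover_blockScalar_of_not_adBall hϖ hd h01 haR with ⟨h1, h2⟩ | ⟨h1, h2⟩
    · exact ⟨(), 0, _, hd', h1, h2⟩
    · exact ⟨(), 1, _, hd', h1, h2⟩
  -- the six structural hypotheses (★ (B-Iw) F1, ★ (B-val) part 1)
  have hIw : ∀ r, ∀ k ∈ K₀, ∃ v ∈ K₀ ⊓ V r, ∃ t ∈ K₀ ⊓ T r, ∃ u ∈ K₀ ⊓ U r, k = v * t * u := by
    intro r k hk; fin_cases r
    · exact exists_iwahori_vtu_of_mem_congruenceGL hγ1 hk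
    · exact exists_iwahori_vtu_of_mem_congruenceGL hγ1 hk
  have h54 : ∀ r, ∀ u ∈ U r, ∀ a' ∈ A, ∀ k : ℕ, u * a' ∈ Ω k → u ∈ Ω (2 * k) := by
    intro r u hu a' ha' k huk
    have hd' := (hAd a' ha').1
    fin_cases r
    · exact adBall_two_mul_of_mem_unipotentRadicalGL (![0, 0, 1] : Fin 3 → Fin 2) ϖ hd' hu huk
    · exact adBall_two_mul_of_mem_unipotentRadicalGL (![1, 1, 0] : Fin 3 → Fin 2) ϖ hd' hu huk
  have hϖh1 : ∀ h : ℕ, Valued.v (ϖ ^ h) ≤ 1 := fun h => by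
    rw [CartanUnique.v_uniformizer_pow hϖ h, ← WithZero.exp_zero, WithZero.exp_le_exp]; omega
  have hV' : ∀ r, ∀ a ∈ P r, ∀ v ∈ K₀ ⊓ V r, a * v * a⁻¹ ∈ K₀ := by
    intro r a ha v hv; fin_cases r
    · obtain ⟨d, hd, h1, -⟩ := ha
      exact conj_mem_congruenceGL_of_mem_oppositeRadical (![0, 0, 1] : Fin 3 → Fin 2) hd (fun i j hij => (h1 i j hij).trans (hϖh1 _))
        (Subgroup.mem_inf.1 hv).1 (Subgroup.mem_inf.1 hv).2
    · obtain ⟨d, hd, h1, -⟩ := ha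
      exact conj_mem_congruenceGL_of_mem_oppositeRadical (![1, 1, 0] : Fin 3 → Fin 2) hd (fun i j hij => (h1 i j hij).trans (hϖh1 _))
        (Subgroup.mem_inf.1 hv).1 (Subgroup.mem_inf.1 hv).2
  have hT' : ∀ r, ∀ a ∈ P r, ∀ t ∈ K₀ ⊓ T r, a * t * a⁻¹ ∈ Ω (D r) := by
    intro r a ha t ht; fin_cases r
    · obtain ⟨d, hd, -, h2⟩ := ha
      exact adBall_conj_of_mem_standardLeviGL (![0, 0, 1] : Fin 3 → Fin 2) ϖ hd h2 (Subgroup.mem_inf.1 ht).1 (Subgroup.mem_inf.1 ht).2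
    · obtain ⟨d, hd, -, h2⟩ := ha
      exact adBall_conj_of_mem_standardLeviGL (![1, 1, 0] : Fin 3 → Fin 2) ϖ hd h2 (Subgroup.mem_inf.1 ht).1 (Subgroup.mem_inf.1 ht).2
  have hnormU : ∀ r, ∀ a ∈ P r, ∀ u ∈ U r, a * u * a⁻¹ ∈ U r := by
    intro r a ha u hu; fin_cases r
    · obtain ⟨d, hd, -, -⟩ := ha; exact conj_mem_unipotentRadicalGL_of_coe_eq_diagonal (![0, 0, 1] : Fin 3 → Fin 2) hd hu
    · obtain ⟨d, hd, -, -⟩ := ha; exact conj_mem_unipotentRadicalGL_of_coe_eq_diagonal (![1, 1, 0] : Fin 3 → Fin 2) hd hu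
  have hcontr : ∀ r, ∀ a ∈ P r, ∀ (k j : ℕ), j + k ≤ m + 2 * s + (4 * mC + 2 * D r) + 1 → ∀ u ∈ U r, u ∈ Ω k → a⁻¹ * u * a ∈ L j := by
    intro r a ha k j hjk u hu huk; fin_cases r
    · obtain ⟨d, hd, h1, -⟩ := ha
      exact inv_conj_mem_congruenceGL_of_adBall (![0, 0, 1] : Fin 3 → Fin 2) hϖ hd h1 hu huk (by simp [hD] at hjk; omega)
    · obtain ⟨d, hd, h1, -⟩ := ha
      exact inv_conj_mem_congruenceGL_of_adBall (![1, 1, 0] : Fin 3 → Fin 2) hϖ hd h1 hu huk (by simp [hD] at hjk; omega)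
  -- assemble: ★ (A′) with `W = Unit` on the level `K₁ = GL₃(𝒪)`
  have hx' : x ∉ Ω (mC + E + s) := hx
  exact cuspForm_cancellation_polychotomy_levelOne_of_base μ Ω hΩmul hΩinv (glInt 3 F) K₀ A T U V P D L w
    (fun _ k hk => by simpa only [hw, one_mul, inv_one, mul_one] using hk) (fun _ k hk => by simpa only [hw, one_mul, inv_one, mul_one] using hk)
    (fun _ k g hg => by simpa only [hw, one_mul, inv_one, mul_one] using hg) (fun _ k g hg => by simpa only [hw, one_mul, inv_one, mul_one] using hg)
    (fun _ j g hg => by simpa only [hw, one_mul, inv_one, mul_one] using hg) (fun _ a ha => by simpa only [hw, one_mul, inv_one, mul_one] using ha)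
    hK₁Ω hK₀K₁ hK₁o hK₁c hK₀o hK₀c hy hdeep hUc f hf _ hCΩ hsupp hcusp hcover hIw h54 hV' hT' hnormU hcontr hx'

end BlockScalar

end Summit.HodgeConjecture.HodgeConjecture.Cruxes.H413.K2E3GL3CuspFormCancellationBlockScalar

end
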